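import Literature.MathematicalPhysics.QuantumFieldTheory.Balaban1983to89.B8IdxB8SubDPrintClassGap
import Literature.MathematicalPhysics.QuantumFieldTheory.Balaban1983to89.Node00.CarriersB8SubBPCutP5

/-!
# `Balaban1983to89.B8Slot8CutClassSG1` — [Balaban1985RegularSpaces] (1.3)–(1.4) p. 77, Thm 2 p. 83 – Thm 8 p. 101 (the family the theorems speak about): THE DECIDING KERNEL QUESTION Q-SG1 OF THE
# pub-ymgap CELL (director-ym №220 (A-1), 2026-08-28) — «does the minimal-tower witness of `B8IdxB8SubDPrintClassGap` survive the slot's own cut `λ₈.cutSubBP₅ c₁ ρ₀`?» — ANSWER: «SURVIVES»,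
# because the cut NEVER touches the family index over which Theorem 2 ∕ Proposition 3 ∕ Theorem 4 ∕ Proposition 7 ∕ Theorem 8 of the slot are quantified: that index is `Node00.IdxB8SubD θ`
# at EVERY guard pair `(c₁, ρ₀)` (`rfl`), and `IdxB8SubD θ` carries a member outside print's (1.3)–(1.4) class at every depth `k ≥ 2` (p628350)

statement-level skeleton of published theorems with citation tags; proofs where landed; nothing here is a claim about the Yang–Mills mass gap

T. Bałaban, *Spaces of regular gauge field configurations on a lattice and gauge fixing conditions*, Commun. Math. Phys. **99** (1985) 75–102 `[Balaban1985RegularSpaces]`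
— (1.3)–(1.4) p. 77 (the admissible class «Ω_j is a sum of cubes of a size M₁Lʲη, (Lʲη)⁻¹dist(Ω_jᶜ, Ω_{j+1}) > RM₁»), Thm 2 p. 83, Prop. 3 p. 87, Thm 4 p. 88, Prop. 5 p. 94, Prop. 6 p. 99, Prop. 7 p. 100,
Thm 8 p. 101 (the statements are about «sequences of domains Ω_j ⊂ T_η satisfying (1.3), (1.4)»).

WHY (cell pub-ymgap, N05 [B8]; referee ref-L g11 SECOND-GAP #550 on this seat's g5 certificate `B8IdxB8SubDPrintClassGap` (p628350): the (1.5)-keyed leaf index `IdxB8SubD θ` is STRICTLY WIDER than print's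
(1.3)–(1.4) class `B8Eq134Admissible.Admissible134 θ.L M₁ R`; director-ym №220 (A) opened FLAG №10 «N05 CLASS — STRONGER-THAN-PRINT AS TYPED» and asked (A-1) the deciding question Q-SG1: the slot of record is
`Slot8 := ∃ c₁ ρ₀, B8LeafOfRecordSubBP₂D θ₃ (λ₈.cutSubBP₅ c₁ ρ₀)` (VERDICT-415) — does some guard-admissible pair `(0 < c₁, 1 ≤ ρ₀)` already EXCLUDE every non-class member («EXCLUDED-BY-CUT», then №10 folds
into №4's guard rule), or does the witness SURVIVE every such cut («SURVIVES», then exit 2 CUT is necessary for N05 ever to be dischargeable and rides one statement edition, №220 (A-3)∕(A-5))?).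
THE READING, first-hand: `Node00/CarriersB8SubBP2D` :162 `B8LeafOfRecordSubBP₂D θ lam := B8LeafRSC … (fun j : IdxB8SubD θ => famB8OfRecordSubBP₂D θ lam.β lam.len j) lam.lan lam.cub (fun j => toAxialTowerResid …)` —
the Thm 2 ∕ Prop 3 ∕ Thm 4 ∕ Prop 7 ∕ Thm 8 family index is `IdxB8SubD θ`, a constant of the slot text; `Node00/CarriersB8SubBPCutP5` :161 `ResidB8.cutSubBP₅ λ c₁ ρ₀` re-pins only the residual layer's
Proposition-5 index ∕ members (`I8c := IdxB8LanC θ` = ALL (1.5)-members × unitary backgrounds), Proposition-6 carriers (`I8d := IdxB8SubB θ`, `cub := zdCubP … ρ₀`) and the constant `c₁`.  So the pair `(c₁, ρ₀)`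
never reads the family index, and the g5 witness (the minimal-margin tower `cubeFam true θ.L (fun _ ↦ L+1) 1 L k`) is a member of the cut slot's family index for EVERY pair.

WHAT IS PROVED (0 `def`, 0 sorry; std axioms; pure bookkeeping + p628350 BY NAME):
* `I8b_withB8OfRecordSubBP₂D_cutSubBP₅` (`rfl`: the substituted bundle's [B8] family index at the cut is `IdxB8SubD θ`, any `c₁ ρ₀`), `I8c_cutSubBP₅` (`rfl`: Prop. 5's index is `IdxB8LanC θ`),
  `t2_of_slot8_cut` ∕ `t8_of_slot8_cut` (the cut slot's Theorem-2 ∕ Theorem-8 conjuncts ARE the printed sentences over `fun j : IdxB8SubD θ => famB8OfRecordSubBP₂D θ λ.β λ.len j`, any `c₁ ρ₀`).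
* ★★ `sg1_survives_cut` — **Q-SG1 = «SURVIVES»**: for every `0 < c₁`, `1 ≤ ρ₀`, every print regime `2 ≤ M₁ ∨ θ.L + 1 ≤ R·M₁` and every depth `k ≥ 2` there is a member `j` of the cut slot's family index
  `(X.withB8OfRecordSubBP₂D θ (λ.cutSubBP₅ c₁ ρ₀)).I8b` with `j.k = k` and `¬ Admissible134 θ.L M₁ R k j.Ω`; ★ `sg1_not_excluded_by_cut` (no guard-admissible pair excludes the non-class members);
  `sg1_survives_cut_lanC` (Proposition 5's index `(λ.cutSubBP₅ c₁ ρ₀).I8c` likewise carries a non-admissible member, at the unitary background `U₀ := 1`).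

HONEST FRAMING: a kernel answer to a referee ∕ director question about the TYPED TEXT of the slot (which family the printed theorems are demanded over); `rfl` bookkeeping + the g5 certificate by name; NO
estimate; nothing of Bałaban's asserted or refuted; no statement, slot, index or pin edited or proposed (the edition, if any, is the planners' per №220 (A-5)); count-neutral; N05 NOT discharged; one finite 𝕋⁴
programme at fixed ε, Bałaban AS PRINTED — NOT continuum ∕ ℝ⁴ ∕ OS ∕ mass gap ∕ Clay.  No `sorry`, no `instance`, no `notation`. -/

noncomputable section

namespace Literature.MathematicalPhysics.QuantumFieldTheory.Balaban1983to89.B8Slot8CutClassSG1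

open DagBinding (PrintedCarriersR)
open B7Prop2Explicit (unitaryUnits)
open B8Eq134Admissible (Admissible134)
open B8IdxB8SubDPrintClassGap (exists_idxB8SubD_not_admissible134)
open Node00 (Stage3Params IdxB8SubD IdxB8LanC ResidB8 B8LeafOfRecordSubBP₂D famB8OfRecordSubBP₂D)

variable {θ : Stage3Params}

/-! ## The cut never touches the family index -/

/-- **THE [B8] FAMILY INDEX OF THE SUBSTITUTED BUNDLE AT THE CUT IS `IdxB8SubD θ`, FOR EVERY GUARD PAIR `(c₁, ρ₀)`** (`rfl`). [cite: Balaban1985RegularSpaces, Thm 2 p.83 – Thm 8 p.101 (bookkeeping: the family index of the typed statements)] -/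
theorem I8b_withB8OfRecordSubBP₂D_cutSubBP₅ (X : PrintedCarriersR) (lam : ResidB8 θ) (c₁ : ℝ) (ρ₀ : ℕ) :
    (X.withB8OfRecordSubBP₂D θ (lam.cutSubBP₅ c₁ ρ₀)).I8b = IdxB8SubD θ := rfl

/-- Proposition 5's index at the cut is `IdxB8LanC θ` — every (1.5)-member with every unitary background (`rfl`, dag-n05-w1's face restated at the bundle level for the record).
[cite: Balaban1985RegularSpaces, Prop. 5 p.94 (bookkeeping)] -/
theorem I8c_cutSubBP₅ (lam : ResidB8 θ) (c₁ : ℝ) (ρ₀ : ℕ) : (lam.cutSubBP₅ c₁ ρ₀).I8c = IdxB8LanC θ := rfl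

/-- **The cut slot's Theorem-2 conjunct IS Theorem 2 over the WHOLE (1.5)-keyed index `IdxB8SubD θ`**, whatever `(c₁, ρ₀)` (the layer's `β, len` are untouched by the cut: `rfl`).
[cite: Balaban1985RegularSpaces, Thm 2 p.83, (1.33)–(1.39) pp.82–83] -/
theorem t2_of_slot8_cut (lam : ResidB8 θ) (c₁ : ℝ) (ρ₀ : ℕ) (h : B8LeafOfRecordSubBP₂D θ (lam.cutSubBP₅ c₁ ρ₀)) :
    B8.Thm2Printed (fun j : IdxB8SubD θ => (famB8OfRecordSubBP₂D θ lam.β lam.len j).toGFData) :=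
  h.t2

/-- **… and its Theorem-8 (surviving) conjunct likewise ranges over all of `IdxB8SubD θ`.** [cite: Balaban1985RegularSpaces, Thm 8 (1.146) p.101] -/
theorem t8_of_slot8_cut (lam : ResidB8 θ) (c₁ : ℝ) (ρ₀ : ℕ) (h : B8LeafOfRecordSubBP₂D θ (lam.cutSubBP₅ c₁ ρ₀)) :
    B8Thm8Surviving.Thm8SurvivingAt 1 lam.B₁ lam.B₂ (fun j : IdxB8SubD θ => famB8OfRecordSubBP₂D θ lam.β lam.len j) :=
  h.t8

/-! ## Q-SG1: the minimal-tower witness survives every cut -/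

/-- ★★ **Q-SG1 = «SURVIVES»**: for EVERY guard-admissible pair `(0 < c₁, 1 ≤ ρ₀)` (the №4 rule), every print-regime choice of the (1.4) constants (`2 ≤ M₁ ∨ θ.L + 1 ≤ R·M₁`; print: «M₁ much bigger than
δ₀⁻¹», «R a sufficiently large power of L») and every depth `k ≥ 2`, the family index over which the CUT slot `B8LeafOfRecordSubBP₂D θ (λ.cutSubBP₅ c₁ ρ₀)` demands Theorems 2∕4∕8 and Propositions 3∕7 carries a
member `j` of depth `k` whose domains VIOLATE print's literal (1.3)–(1.4) `Admissible134 θ.L M₁ R` — this seat's g5 minimal-margin tower (`B8IdxB8SubDPrintClassGap.exists_idxB8SubD_not_admissible134`); the guard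
hypotheses are displayed and IDLE, which is the content: `(c₁, ρ₀)` never reads the family index. [cite: Balaban1985RegularSpaces, (1.3)–(1.4) p.77, Thm 2 p.83, Prop. 6 p.99 (c₁), Sect. F p.98 (ρ₀ = R₁M₁)] -/
theorem sg1_survives_cut (X : PrintedCarriersR) (lam : ResidB8 θ) {c₁ : ℝ} (_hc₁ : 0 < c₁) {ρ₀ : ℕ} (_hρ₀ : 1 ≤ ρ₀) {M₁ R : ℕ} (hreg : 2 ≤ M₁ ∨ θ.L + 1 ≤ R * M₁)
    {k : ℕ} (hk : 2 ≤ k) :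
    ∃ j : (X.withB8OfRecordSubBP₂D θ (lam.cutSubBP₅ c₁ ρ₀)).I8b, j.1.1.1.1.k = k ∧ ¬ Admissible134 θ.L M₁ R k j.1.1.1.1.Ω :=
  exists_idxB8SubD_not_admissible134 θ hreg hk

/-- The same with the conclusion read at the member's own depth `j.k`. [cite: Balaban1985RegularSpaces, (1.3)–(1.4) p.77] -/
theorem sg1_survives_cut' (X : PrintedCarriersR) (lam : ResidB8 θ) {c₁ : ℝ} (_hc₁ : 0 < c₁) {ρ₀ : ℕ} (_hρ₀ : 1 ≤ ρ₀) {M₁ R : ℕ} (hreg : 2 ≤ M₁ ∨ θ.L + 1 ≤ R * M₁) :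
    ∃ j : (X.withB8OfRecordSubBP₂D θ (lam.cutSubBP₅ c₁ ρ₀)).I8b, ¬ Admissible134 θ.L M₁ R j.1.1.1.1.k j.1.1.1.1.Ω := by
  obtain ⟨j, hjk, hj⟩ := exists_idxB8SubD_not_admissible134 θ hreg (le_refl 2)
  exact ⟨j, by rw [hjk]; exact hj⟩

/-- ★ **NOT «EXCLUDED-BY-CUT»**: no guard-admissible pair `(c₁, ρ₀)` makes every member of the cut slot's family index print-admissible (for any print-regime `(M₁, R)`).
[cite: Balaban1985RegularSpaces, (1.3)–(1.4) p.77, Prop. 6 p.99, Sect. F p.98] -/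
theorem sg1_not_excluded_by_cut (X : PrintedCarriersR) (lam : ResidB8 θ) {M₁ R : ℕ} (hreg : 2 ≤ M₁ ∨ θ.L + 1 ≤ R * M₁) :
    ¬ ∃ c₁ : ℝ, 0 < c₁ ∧ ∃ ρ₀ : ℕ, 1 ≤ ρ₀ ∧ ∀ j : (X.withB8OfRecordSubBP₂D θ (lam.cutSubBP₅ c₁ ρ₀)).I8b, Admissible134 θ.L M₁ R j.1.1.1.1.k j.1.1.1.1.Ω := by
  rintro ⟨c₁, hc₁, ρ₀, hρ₀, hall⟩
  obtain ⟨j, hj⟩ := sg1_survives_cut' X lam hc₁ hρ₀ hreg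
  exact hj (hall j)

/-- **Proposition 5's index at the cut also carries a non-admissible member** (the same tower with the unitary background `U₀ := 1`): the cut's `I8c = IdxB8LanC θ` is «every (1.5)-member × every unitary
background», not a print-class family either. [cite: Balaban1985RegularSpaces, Prop. 5 p.94 («for U₀ ∈ 𝔄_k({Ω_j}, α₀)»), (1.3)–(1.4) p.77] -/
theorem sg1_survives_cut_lanC (lam : ResidB8 θ) {c₁ : ℝ} (_hc₁ : 0 < c₁) {ρ₀ : ℕ} (_hρ₀ : 1 ≤ ρ₀) {M₁ R : ℕ} (hreg : 2 ≤ M₁ ∨ θ.L + 1 ≤ R * M₁) {k : ℕ} (hk : 2 ≤ k) :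
    ∃ a : (lam.cutSubBP₅ c₁ ρ₀).I8c, a.mem.1.1.1.1.k = k ∧ ¬ Admissible134 θ.L M₁ R k a.mem.1.1.1.1.Ω := by
  obtain ⟨j, hjk, hj⟩ := exists_idxB8SubD_not_admissible134 θ hreg hk
  exact ⟨⟨j, fun _ _ => 1, fun _ _ => Subgroup.one_mem _⟩, hjk, hj⟩

end Literature.MathematicalPhysics.QuantumFieldTheory.Balaban1983to89.B8Slot8CutClassSG1

end
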